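import Summits.RiemannHypothesis.RiemannHypothesis.Theorems.SemilocalNegCertEleven
import Summits.RiemannHypothesis.RiemannHypothesis.Theorems.SemilocalLogAtomsB
import Summits.RiemannHypothesis.RiemannHypothesis.Theorems.SemilocalLogAtomsC
import HarnessLib

/-!
# Semi-local threshold of the `{∞} ∪ {p < 43}` form, negative side: `a*({2,…,41}) ≤ 61/32` (the wall `q = 43`)

Cell `rh-explicit` (HOME `run/shared/lean/pub/rh-explicit/`), seat cc-s2-4 gen8 (A4-EXT item (1): theorem upper ends for the walls
`q ≤ 53`; `S = S_43 = {2, 3, 5, 7, 11, 13, 17, 19, 23, 29, 31, 37, 41}`, class `2, …, 41 ∈ S ∌ 43`).  Honest framing: theorems about the tree's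
`weilSemilocalThreshold S`; nothing here bears on RH.  No data is trusted: 12 kernel facts (`decide +kernel`) of the PIECEWISE
certificate `certUptoFortyOne` (`WeilNegCertP`, `SemilocalNegCertPieces.lean`; window `2b = 61 / 16`, bulk in 10 pieces,
centred majorant `archMajorCL 10 4 5 u₀`).

Instance data: window `N = 45` (`2b < log 46`), atoms = the `S`-smooth prime powers `≤ 45`:
`2, 3, 4, 5, 7, 8, 9, 11, 13, 16, 17, 19, 23, 25, 27, 29, 31, 32, 37, 41` (enclosures `SemilocalLogAtoms{,B,C}.lean`).  Witness: bottom vector of the odd Legendre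
section `d = 11` at `b = 61/32` from this seat's exact-kappa finder (`polyfind.py`, HOME/cc-s2-4/gen7/): `Re Q_S(G)/‖G‖² =
−4.1769·10⁻⁴` ⇒ **`weilSemilocalThreshold {2, 3, 5, 7, 11, 13, 17, 19, 23, 29, 31, 37, 41} ≤ 61/32`**.  The window sits just beyond the KNEE of the wall
(`b ≈ a*(S_43) + 0.01`: past it the finite-degree sections turn strongly negative and degree 11 suffices; closer to `a*`
the same witness class needs degree ≥ 25 — gen7, CC4-LEAN §12.5; knee table CC4-LEAN §13).  Locality (`N = 45`): **`a*(S) = a*(S_43) ∈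
[0.8046, 61/32]` for every finite `S ⊇ S_43` with `43 ∉ S`** (DATA: a*(S_43) ∈ (1.880650, 1.880656] (cc6, N = 400)).  Folklore throughout.
-/

set_option autoImplicit false
set_option linter.dupNamespace false  -- the mandated namespace repeats `RiemannHypothesis`

noncomputable section

open Complex Filter Set MeasureTheory Topology
open scoped Real

namespace Summit.RiemannHypothesis.RiemannHypothesis.Theorems.SemilocalPolyWitness

open MeasureTheory Set Finset Real
open Literature.NumberTheory.LFunctions
open Summit.RiemannHypothesis.RiemannHypothesis.Theorems.MotivicDoor
open Summit.RiemannHypothesis.RiemannHypothesis.Theorems.MotivicDoor.SemilocalThreshold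
open Summit.RiemannHypothesis.RiemannHypothesis.Theorems.MotivicDoor.SemilocalMarkov
open LQ


/-! ### The atom table of the `{2, 3, 5, 7, 11, 13, 17, 19, 23, 29, 31, 37, 41}`-form on windows `b < (log 46)/2` (`N = 45`) -/

/-- The atoms of the `{2, 3, 5, 7, 11, 13, 17, 19, 23, 29, 31, 37, 41}`-form below `(log 46)/2`: `2, 3, 4, 5, 7, 8, 9, 11, 13, 16, 17, 19, 23, 25, 27, 29, 31, 32, 37, 41`. -/
def atomsUptoFortyOne : List (ℕ × AtomQ) := [atomTwo, atomThree, atomFour, atomFive, atomSeven, atomEight, atomNine, atomEleven, atomThirteen, atomSixteen, atomSeventeen, atomNineteen, atomTwentyThree, atomTwentyFive, atomTwentySeven, atomTwentyNine, atomThirtyOne, atomThirtyTwo, atomThirtySeven, atomFortyOne]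

/-- A rational lower bound of `log 46`. -/
def logSuccLoUptoFortyOne : ℚ := logTwoLo20 + logTwentyThreeLo

/-- **The atom table encloses `({2, 3, 5, 7, 11, 13, 17, 19, 23, 29, 31, 37, 41}, 45)`.** -/
theorem atomsEnclose_UptoFortyOne : AtomsEnclose {2, 3, 5, 7, 11, 13, 17, 19, 23, 29, 31, 37, 41} 45 atomsUptoFortyOne logSuccLoUptoFortyOne where
  nodup := by decide
  lt_succ := by decide
  cover := by
    intro n hn hnot
    simp only [atomsUptoFortyOne, atomTwo, atomThree, atomFour, atomFive, atomSeven, atomEight, atomNine, atomEleven, atomThirteen, atomSixteen, atomSeventeen, atomNineteen, atomTwentyThree, atomTwentyFive, atomTwentySeven, atomTwentyNine, atomThirtyOne, atomThirtyTwo, atomThirtySeven, atomFortyOne, List.map_cons, List.map_nil, List.mem_cons,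
      List.not_mem_nil, or_false, not_or] at hnot
    have hn' : n < 46 := Finset.mem_range.1 hn
    interval_cases n
    · exact weilSemilocalCoeff_of_not_isPrimePow _ (by decide)
    · exact weilSemilocalCoeff_of_not_isPrimePow _ (by decide)
    · simp at hnot
    · simp at hnot
    · simp at hnot
    · simp at hnot
    · exact weilSemilocalCoeff_of_not_isPrimePow _ (by decide)
    · simp at hnot
    · simp at hnot
    · simp at hnot
    · exact weilSemilocalCoeff_of_not_isPrimePow _ (by decide)
    · simp at hnot
    · exact weilSemilocalCoeff_of_not_isPrimePow _ (by decide)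
    · simp at hnot
    · exact weilSemilocalCoeff_of_not_isPrimePow _ (by decide)
    · exact weilSemilocalCoeff_of_not_isPrimePow _ (not_isPrimePow_of_two_primes_dvd Nat.prime_three (by norm_num : Nat.Prime 5) (by norm_num) (by norm_num) (by norm_num))
    · simp at hnot
    · simp at hnot
    · exact weilSemilocalCoeff_of_not_isPrimePow _ (by decide)
    · simp at hnot
    · exact weilSemilocalCoeff_of_not_isPrimePow _ (by decide)
    · exact weilSemilocalCoeff_of_not_isPrimePow _ (not_isPrimePow_of_two_primes_dvd Nat.prime_three (by norm_num : Nat.Prime 7) (by norm_num) (by norm_num) (by norm_num))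
    · exact weilSemilocalCoeff_of_not_isPrimePow _ (by decide)
    · simp at hnot
    · exact weilSemilocalCoeff_of_not_isPrimePow _ (by decide)
    · simp at hnot
    · exact weilSemilocalCoeff_of_not_isPrimePow _ (by decide)
    · simp at hnot
    · exact weilSemilocalCoeff_of_not_isPrimePow _ (by decide)
    · simp at hnot
    · exact weilSemilocalCoeff_of_not_isPrimePow _ (by decide)
    · simp at hnot
    · simp at hnot
    · exact weilSemilocalCoeff_of_not_isPrimePow _ (not_isPrimePow_of_two_primes_dvd Nat.prime_three (by norm_num : Nat.Prime 11) (by norm_num) (by norm_num) (by norm_num))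
    · exact weilSemilocalCoeff_of_not_isPrimePow _ (by decide)
    · exact weilSemilocalCoeff_of_not_isPrimePow _ (not_isPrimePow_of_two_primes_dvd (by norm_num : Nat.Prime 5) (by norm_num : Nat.Prime 7) (by norm_num) (by norm_num) (by norm_num))
    · exact weilSemilocalCoeff_of_not_isPrimePow _ (by decide)
    · simp at hnot
    · exact weilSemilocalCoeff_of_not_isPrimePow _ (by decide)
    · exact weilSemilocalCoeff_of_not_isPrimePow _ (not_isPrimePow_of_two_primes_dvd Nat.prime_three (by norm_num : Nat.Prime 13) (by norm_num) (by norm_num) (by norm_num))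
    · exact weilSemilocalCoeff_of_not_isPrimePow _ (by decide)
    · simp at hnot
    · exact weilSemilocalCoeff_of_not_isPrimePow _ (by decide)
    · exact weilSemilocalCoeff_prime_of_not_mem (by norm_num) (by decide)
    · exact weilSemilocalCoeff_of_not_isPrimePow _ (by decide)
    · exact weilSemilocalCoeff_of_not_isPrimePow _ (not_isPrimePow_of_two_primes_dvd Nat.prime_three (by norm_num : Nat.Prime 5) (by norm_num) (by norm_num) (by norm_num))
  encl := by
    intro na hna
    simp only [atomsUptoFortyOne, List.mem_cons, List.not_mem_nil, or_false] at hna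
    rcases hna with rfl | rfl | rfl | rfl | rfl | rfl | rfl | rfl | rfl | rfl | rfl | rfl | rfl | rfl | rfl | rfl | rfl | rfl | rfl | rfl
    · exact atomTwo_encl (by decide)
    · exact atomThree_encl (by decide)
    · exact atomFour_encl (by decide)
    · exact atomFive_encl (by decide)
    · exact atomSeven_encl (by decide)
    · exact atomEight_encl (by decide)
    · exact atomNine_encl (by decide)
    · exact atomEleven_encl (by decide)
    · exact atomThirteen_encl (by decide)
    · exact atomSixteen_encl (by decide)
    · exact atomSeventeen_encl (by decide)
    · exact atomNineteen_encl (by decide)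
    · exact atomTwentyThree_encl (by decide)
    · exact atomTwentyFive_encl (by decide)
    · exact atomTwentySeven_encl (by decide)
    · exact atomTwentyNine_encl (by decide)
    · exact atomThirtyOne_encl (by decide)
    · exact atomThirtyTwo_encl (by decide)
    · exact atomThirtySeven_encl (by decide)
    · exact atomFortyOne_encl (by decide)
  logSucc := by
    have h2 := logTwoLo20_le
    have h23 := logTwentyThreeLo_le
    have h46 : Real.log (((45 : ℕ) : ℝ) + 1) = Real.log 2 + Real.log 23 := by
      rw [show ((45 : ℕ) : ℝ) + 1 = 2 * 23 by norm_num, Real.log_mul (by norm_num) (by norm_num)]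
    rw [h46, logSuccLoUptoFortyOne]; push_cast; linarith

/-! ### The certificates -/

/-- The degree-11 witness at `b = 61 / 32` (bottom vector of the odd Legendre section d = 11 at b = 61/32, rounded to 8 digits; exact-kappa finder value Re Q_S/‖G‖² = −4.1769·10⁻⁴; kernel margin (rhs − lhs)/‖G‖² = 3.78e-4), in powers of `x`. -/
def pUptoFortyOne : List ℚ :=
  [0, 97023398725 / 488, 0, -222260522359680 / 226981, 0, 1064771953227988992 / 844596301, 0, -2016337217972059766784 / 3142742836021, 0, 1693368586057625202851840 / 11694146092834141, 0, -531443791937369502438653952 / 43513917611435838661]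

/-- The piecewise certificate at `b = 61 / 32`: orders `(nA, mA, KA, Kt, nt, ne) = (10, 4, 5, 10, 40, 16)`, cuts `[1, 3 / 2, 19 / 10, 11 / 5, 5 / 2, 57 / 20, 16 / 5, 173 / 50, 37 / 10, 61 / 16]`,
claimed piece bounds and atom bound (exact rational values rounded up to integers). -/
def certUptoFortyOne : WeilNegCertP :=
  ⟨pUptoFortyOne, 61 / 32, 10, 4, 5, 10, 40, 16, atomsUptoFortyOne, logSuccLoUptoFortyOne,
   [1, 3 / 2, 19 / 10, 11 / 5, 5 / 2, 57 / 20, 16 / 5, 173 / 50, 37 / 10, 61 / 16],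
   [25869096853090568, 6418711389865806, 5406573242509550, 2920262368961391, 1929465513833356, 2580038701472438, 2834688754769715, 1631847733739544, 1131427691344155, 455476981089056], 298169601500762745⟩

set_option maxHeartbeats 0 in
/-- kernel fact: side conditions and the final inequality of `certUptoFortyOne`. -/
theorem check_UptoFortyOne_main : certUptoFortyOne.checkMain c0SharpQ = true := by
  decide +kernel

set_option maxHeartbeats 0 in
/-- kernel fact: the atom side of `certUptoFortyOne`. -/
theorem check_UptoFortyOne_atoms : certUptoFortyOne.checkAtoms = true := by
  decide +kernel

set_option maxHeartbeats 0 in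
/-- kernel fact: piece `0` of `certUptoFortyOne`. -/
theorem check_UptoFortyOne_piece0 : certUptoFortyOne.checkPiece 0 = true := by
  decide +kernel

set_option maxHeartbeats 0 in
/-- kernel fact: piece `1` of `certUptoFortyOne`. -/
theorem check_UptoFortyOne_piece1 : certUptoFortyOne.checkPiece 1 = true := by
  decide +kernel

set_option maxHeartbeats 0 in
/-- kernel fact: piece `2` of `certUptoFortyOne`. -/
theorem check_UptoFortyOne_piece2 : certUptoFortyOne.checkPiece 2 = true := by
  decide +kernel

set_option maxHeartbeats 0 in
/-- kernel fact: piece `3` of `certUptoFortyOne`. -/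
theorem check_UptoFortyOne_piece3 : certUptoFortyOne.checkPiece 3 = true := by
  decide +kernel

set_option maxHeartbeats 0 in
/-- kernel fact: piece `4` of `certUptoFortyOne`. -/
theorem check_UptoFortyOne_piece4 : certUptoFortyOne.checkPiece 4 = true := by
  decide +kernel

set_option maxHeartbeats 0 in
/-- kernel fact: piece `5` of `certUptoFortyOne`. -/
theorem check_UptoFortyOne_piece5 : certUptoFortyOne.checkPiece 5 = true := by
  decide +kernel

set_option maxHeartbeats 0 in
/-- kernel fact: piece `6` of `certUptoFortyOne`. -/
theorem check_UptoFortyOne_piece6 : certUptoFortyOne.checkPiece 6 = true := by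
  decide +kernel

set_option maxHeartbeats 0 in
/-- kernel fact: piece `7` of `certUptoFortyOne`. -/
theorem check_UptoFortyOne_piece7 : certUptoFortyOne.checkPiece 7 = true := by
  decide +kernel

set_option maxHeartbeats 0 in
/-- kernel fact: piece `8` of `certUptoFortyOne`. -/
theorem check_UptoFortyOne_piece8 : certUptoFortyOne.checkPiece 8 = true := by
  decide +kernel

set_option maxHeartbeats 0 in
/-- kernel fact: piece `9` of `certUptoFortyOne`. -/
theorem check_UptoFortyOne_piece9 : certUptoFortyOne.checkPiece 9 = true := by
  decide +kernel

/-- all pieces of `certUptoFortyOne` check. -/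
theorem check_UptoFortyOne_pieces : ∀ i, i < certUptoFortyOne.cuts.length → certUptoFortyOne.checkPiece i = true := by
  intro i hi
  have hi' : i < 10 := hi
  interval_cases i
  · exact check_UptoFortyOne_piece0
  · exact check_UptoFortyOne_piece1
  · exact check_UptoFortyOne_piece2
  · exact check_UptoFortyOne_piece3
  · exact check_UptoFortyOne_piece4
  · exact check_UptoFortyOne_piece5
  · exact check_UptoFortyOne_piece6
  · exact check_UptoFortyOne_piece7
  · exact check_UptoFortyOne_piece8
  · exact check_UptoFortyOne_piece9

/-! ### The theorems -/

/-- **`a*({2,…,41}) ≤ 61/32`.** -/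
theorem weilSemilocalThreshold_uptoFortyOne_le :
    weilSemilocalThreshold {2, 3, 5, 7, 11, 13, 17, 19, 23, 29, 31, 37, 41} ≤ ((61 / 32 : ℚ) : ℝ) :=
  weilSemilocalThreshold_le_of_checkP_sharp certUptoFortyOne atomsEnclose_UptoFortyOne
    check_UptoFortyOne_main check_UptoFortyOne_atoms check_UptoFortyOne_pieces

/-- Failure form: positivity of the `{∞} ∪ S_43` form fails on every cone `C(B)`, `B > 61/32`. -/
theorem not_weilSemilocalPositivityOn_uptoFortyOne_of_gt {B : ℝ} (hB : (61 / 32 : ℝ) < B) :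
    ¬ WeilSemilocalPositivityOn {2, 3, 5, 7, 11, 13, 17, 19, 23, 29, 31, 37, 41} B := by
  rw [not_weilSemilocalPositivityOn_iff_weilSemilocalThreshold_lt]
  have h := weilSemilocalThreshold_uptoFortyOne_le
  push_cast at h
  linarith

/-- `a*({2,…,41}) < (log 46)/2`: below the window of the next index. -/
theorem weilSemilocalThreshold_uptoFortyOne_lt_log_fortysix_half :
    weilSemilocalThreshold {2, 3, 5, 7, 11, 13, 17, 19, 23, 29, 31, 37, 41} < Real.log 46 / 2 := by
  have h := weilSemilocalThreshold_uptoFortyOne_le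
  have e : Real.log 46 = Real.log 2 + Real.log 23 := by
    rw [show (46 : ℝ) = 2 * 23 by norm_num, Real.log_mul (by norm_num) (by norm_num)]
  have h2 := Literature.Analysis.SpecialFunctions.Real.log_two_gt_d20
  have h23 := log_twentythree_gt
  push_cast at h
  rw [e]
  linarith

/-- **The class `2, …, 41 ∈ S ∌ 43`**: `a*(S) = a*({2,…,41})` (locality at `N = 45`). -/
theorem weilSemilocalThreshold_eq_uptoFortyOne {S : Finset ℕ} (h2 : 2 ∈ S) (h3 : 3 ∈ S) (h5 : 5 ∈ S) (h7 : 7 ∈ S) (h11 : 11 ∈ S) (h13 : 13 ∈ S) (h17 : 17 ∈ S) (h19 : 19 ∈ S) (h23 : 23 ∈ S) (h29 : 29 ∈ S) (h31 : 31 ∈ S) (h37 : 37 ∈ S) (h41 : 41 ∈ S)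
    (h43 : 43 ∉ S) : weilSemilocalThreshold S = weilSemilocalThreshold {2, 3, 5, 7, 11, 13, 17, 19, 23, 29, 31, 37, 41} := by
  refine weilSemilocalThreshold_congr (S := {2, 3, 5, 7, 11, 13, 17, 19, 23, 29, 31, 37, 41}) (S' := S) (N := 45) ?_ ?_
  · intro n hn hpp
    interval_cases n
    · exact absurd hpp (by decide)
    · exact absurd hpp (by decide)
    · rw [Nat.prime_two.primeFactors]; simp [h2]
    · rw [Nat.prime_three.primeFactors]; simp [h3]
    · rw [show (4 : ℕ) = 2 ^ 2 by norm_num, Nat.primeFactors_prime_pow two_ne_zero Nat.prime_two]; simp [h2]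
    · rw [(by norm_num : Nat.Prime 5).primeFactors]; simp [h5]
    · exact absurd hpp (by decide)
    · rw [(by norm_num : Nat.Prime 7).primeFactors]; simp [h7]
    · rw [show (8 : ℕ) = 2 ^ 3 by norm_num, Nat.primeFactors_prime_pow (by norm_num) Nat.prime_two]; simp [h2]
    · rw [show (9 : ℕ) = 3 ^ 2 by norm_num, Nat.primeFactors_prime_pow two_ne_zero Nat.prime_three]; simp [h3]
    · exact absurd hpp (by decide)
    · rw [(by norm_num : Nat.Prime 11).primeFactors]; simp [h11]
    · exact absurd hpp (by decide)
    · rw [(by norm_num : Nat.Prime 13).primeFactors]; simp [h13]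
    · exact absurd hpp (by decide)
    · exact absurd hpp (not_isPrimePow_of_two_primes_dvd Nat.prime_three (by norm_num : Nat.Prime 5) (by norm_num)
        (by norm_num) (by norm_num))
    · rw [show (16 : ℕ) = 2 ^ 4 by norm_num, Nat.primeFactors_prime_pow (by norm_num) Nat.prime_two]; simp [h2]
    · rw [(by norm_num : Nat.Prime 17).primeFactors]; simp [h17]
    · exact absurd hpp (by decide)
    · rw [(by norm_num : Nat.Prime 19).primeFactors]; simp [h19]
    · exact absurd hpp (by decide)
    · exact absurd hpp (not_isPrimePow_of_two_primes_dvd Nat.prime_three (by norm_num : Nat.Prime 7) (by norm_num)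
        (by norm_num) (by norm_num))
    · exact absurd hpp (by decide)
    · rw [(by norm_num : Nat.Prime 23).primeFactors]; simp [h23]
    · exact absurd hpp (by decide)
    · rw [show (25 : ℕ) = 5 ^ 2 by norm_num, Nat.primeFactors_prime_pow two_ne_zero (by norm_num : Nat.Prime 5)]; simp [h5]
    · exact absurd hpp (by decide)
    · rw [show (27 : ℕ) = 3 ^ 3 by norm_num, Nat.primeFactors_prime_pow (by norm_num) Nat.prime_three]; simp [h3]
    · exact absurd hpp (by decide)
    · rw [(by norm_num : Nat.Prime 29).primeFactors]; simp [h29]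
    · exact absurd hpp (by decide)
    · rw [(by norm_num : Nat.Prime 31).primeFactors]; simp [h31]
    · rw [show (32 : ℕ) = 2 ^ 5 by norm_num, Nat.primeFactors_prime_pow (by norm_num) Nat.prime_two]; simp [h2]
    · exact absurd hpp (not_isPrimePow_of_two_primes_dvd Nat.prime_three (by norm_num : Nat.Prime 11) (by norm_num)
        (by norm_num) (by norm_num))
    · exact absurd hpp (by decide)
    · exact absurd hpp (not_isPrimePow_of_two_primes_dvd (by norm_num : Nat.Prime 5) (by norm_num : Nat.Prime 7) (by norm_num)
        (by norm_num) (by norm_num))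
    · exact absurd hpp (by decide)
    · rw [(by norm_num : Nat.Prime 37).primeFactors]; simp [h37]
    · exact absurd hpp (by decide)
    · exact absurd hpp (not_isPrimePow_of_two_primes_dvd Nat.prime_three (by norm_num : Nat.Prime 13) (by norm_num)
        (by norm_num) (by norm_num))
    · exact absurd hpp (by decide)
    · rw [(by norm_num : Nat.Prime 41).primeFactors]; simp [h41]
    · exact absurd hpp (by decide)
    · rw [(by norm_num : Nat.Prime 43).primeFactors]; simp [h43]
    · exact absurd hpp (by decide)
    · exact absurd hpp (not_isPrimePow_of_two_primes_dvd Nat.prime_three (by norm_num : Nat.Prime 5) (by norm_num)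
        (by norm_num) (by norm_num))
  · have h := weilSemilocalThreshold_uptoFortyOne_lt_log_fortysix_half
    norm_num
    exact h

/-- **`a*(S) ≤ 61/32` for every finite set of primes `S` with `2, …, 41 ∈ S`, `43 ∉ S`.** -/
theorem weilSemilocalThreshold_le_of_mem_fortyone {S : Finset ℕ} (h2 : 2 ∈ S) (h3 : 3 ∈ S) (h5 : 5 ∈ S) (h7 : 7 ∈ S) (h11 : 11 ∈ S) (h13 : 13 ∈ S) (h17 : 17 ∈ S) (h19 : 19 ∈ S) (h23 : 23 ∈ S) (h29 : 29 ∈ S) (h31 : 31 ∈ S) (h37 : 37 ∈ S) (h41 : 41 ∈ S)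
    (h43 : 43 ∉ S) : weilSemilocalThreshold S ≤ ((61 / 32 : ℚ) : ℝ) := by
  rw [weilSemilocalThreshold_eq_uptoFortyOne h2 h3 h5 h7 h11 h13 h17 h19 h23 h29 h31 h37 h41 h43]
  exact weilSemilocalThreshold_uptoFortyOne_le

/-- **The bracket of the class `2, …, 41 ∈ S ∌ 43`**: `4023/5000 ≤ a*(S) ≤ 61/32` (DATA `a*(S_43) ≈ 1.880656`). -/
theorem weilSemilocalThreshold_mem_Icc_of_mem_fortyone {S : Finset ℕ} (h2 : 2 ∈ S) (h3 : 3 ∈ S) (h5 : 5 ∈ S) (h7 : 7 ∈ S) (h11 : 11 ∈ S) (h13 : 13 ∈ S) (h17 : 17 ∈ S) (h19 : 19 ∈ S) (h23 : 23 ∈ S) (h29 : 29 ∈ S) (h31 : 31 ∈ S) (h37 : 37 ∈ S) (h41 : 41 ∈ S)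
    (h43 : 43 ∉ S) : weilSemilocalThreshold S ∈ Set.Icc (4023 / 5000 : ℝ) ((61 / 32 : ℚ) : ℝ) :=
  ⟨SemilocalTwoThree.le_weilSemilocalThreshold_of_two_three_8046 h2 h3,
    weilSemilocalThreshold_le_of_mem_fortyone h2 h3 h5 h7 h11 h13 h17 h19 h23 h29 h31 h37 h41 h43⟩

end Summit.RiemannHypothesis.RiemannHypothesis.Theorems.SemilocalPolyWitness

end

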